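/-
Copyright (c) 2026 the pub-hodgecm-mathlib formalisation cell (harness21).  Prover seat hodgecm-mathlib-K2E1-p08 (g6), Track B ∕ K2-LIT
(build stream 29), h413 = `stmt-HodgeConjecture-24833`, line `K2_E1_TraceFormulaBeta`, campaign «EIS-R7-BL-SPH-2» (Bernstein–Lapid soft continuation of
the spherical Borel Eisenstein series of `U(1,1)`), file «P2a-ι» part 1 (every rank); dealer K2E1-plan (g5) DEAL 2026-09-04T08:55:26Z (1).
-/
import Summits.HodgeConjecture.HodgeConjecture.Theorems.K2E1BLBorelSpacesU2Defs             -- ★ p858761 (K2E4-p10 g5) BL defs leaf 1 ED. 2: `Z = B(F)∖G(𝔸)` (`borelQuotient`), `borelQuotHeight`, `weightedTruncMeasure`, `supHeight`, `HX`, `pZX`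
import Summits.HodgeConjecture.HodgeConjecture.Theorems.K2E1BLEisensteinInWeightedSpaceU2    -- ★ p858763 (K2E4-p23 g0) §1: the every-rank unfolding `∫⁻_𝔛 Σ'_q ψ(q̃ x̃⁻¹) dμ = C·∫⁻ β ψ dν_G`
import Literature.MeasureTheory.Group.DiscreteFundamentalDomain                              -- ★ strict Borel fundamental domains of discrete subgroups
import HarnessLib

/-!
# h413 ∕ Track B «K2-LIT», campaign «EIS-R7-BL-SPH-2» — helper `K2E1BLIotaUnfoldingU` («P2a-ι», part 1, EVERY RANK): THE UNFOLDING OF THE PULL-BACK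
# `p : Z = B(F)∖G(𝔸) → 𝔛 = G(F)∖G(𝔸)` AGAINST THE WEIGHT `𝟙_{Z_c} H^{−2k}` — `C · ∫⁻_Z F∘p d(wtm) = ∫⁻_𝔛 F · Σ'_{q ∈ B(F)∖G(F)} 𝟙_{c<H(q̃x̃⁻¹)} H(q̃ x̃⁻¹)^{−2k} dμ`

Cell `pub/hodgecm-mathlib`, crux H413 = `stmt-HodgeConjecture-24833`, route of record `HCCMUnconditional`; chair K2-lead (g1), dealer K2E1-plan (g5) (DEAL «P2a-ι» 08:55:26Z:
«discharge of leaf-2's `IotaBound k c μ μZ` + `IsClosed (range ι)` + `Injective ι` from ★ p858750's two-sided weights via the unfolding `∫_{Z_c} F∘p_c·H^{−2k} dμZ =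
∫_𝔛 F·Σ_{q∈S_c} H(q̃·)^{−2k} dμ`»); spec of record = K2E1b-plan (g6) WIRING «EIS-R7-BL-SPH-2» `7d1cceb628a30de8` §3 P2a [BernsteinLapid2019, §4 Claim 4 bullet 1 (arXiv:1911.02342
p. 10): «for `0 < c ≤ c₀` the pull-back via the surjective `p_c` defines a closed embedding `ι_{c,N} : 𝓗_N(𝔛) → 𝓗_N(Z_c)`»].  THEOREMS ONLY (no `def`, no `instance`, no `notation`, no
named-fact hypothesis, no `sorry`); lane `--kind proof --supports stmt-HodgeConjecture-24833 --as helper` (count-neutral).  THIS FILE = the every-rank half (clone discipline: serves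
BL-SPH-3 verbatim); the `N = 2` bounds and the three letters are part 2, `K2E1BLIotaBoundU2`.

CURRENCY (★ p858761 `K2E1BLBorelSpacesU2Defs`, ED. 2 of the defs leaf: `Z = B(F)∖G(𝔸)` — the ONLY quotient on which `p_c` is finite-to-one).  `𝔾 = (quasiSplit F E c N).Adelic`,
`𝔛 = automorphicQuotient = 𝔾 ⧸ G(F)` (Mathlib left cosets; automorphic measure `μ`), `Z = borelQuotient` with `π = toBorelQuotient`, `HZ = borelQuotHeight`, `p = pZX : Z → 𝔛`,
`B(F)·g ↦ [g⁻¹]`, the weighted truncated measure `wtm k c μZ = (μZ|_{c < HZ}).withDensity HZ^{−2k}` (`𝓗_k(Z_c) = L²(wtm)`).  THE MEASURE LETTER on `μZ` ((ζ′) D2 «`μZ` is the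
`B(F)`-quotient of the Haar measure `ν_G`» in covering-weight currency — Mathlib's `QuotientMeasureEqMeasurePreimage` is typed for the `map`-σ-algebra `Quotient.instMeasurableSpace`
on the quotient, NOT for the Borel σ-algebra of ★ leaf 1, so it cannot serve as the letter): **`hμZ : ∀ f ≥ 0 Borel on Z, ∫⁻_Z f dμZ = ∫⁻_𝔾 β · (f ∘ π) dν_G`** for a covering
weight `β` of `B(F)♯ = (arithmeticBorel).map subtype` (★ `IsCoveringWeight`) — weight-INDEPENDENT (★ `lintegral_mul_eq_of_coveringSum_eq`) and NON-VACUOUS (§1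
`exists_measure_forall_lintegral_eq`).

* §1 PLUMBING (every rank): `mem_ratBorelSubgroup_of_mem_map` ∕ `mem_map_of_mem_ratBorelSubgroup` ∕ `ratBorelSubgroup_eq_map` (the two spellings of `B(F) ≤ 𝔾` agree),
  `toBorelQuotient_mul_of_mem_map` (`π(γ g) = π g`), `continuous_borelQuotHeight` ∕ `measurable_borelQuotHeight`, `measurable_pZX`, `discreteTopology_map_arithmeticBorel` (`B(F)♯` is
  discrete, ★ `isDiscreteRational_quasiSplit`), **`exists_measure_forall_lintegral_eq`** (a measure `μZ` satisfying the letter EXISTS: `map π (ν_G|_𝓕)` for a strict Borel fundamental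
  domain `𝓕` of `B(F)♯`, ★ `Subgroup.exists_measurableSet_existsUnique_smul_mem`, ★ `isCoveringWeight_indicator`).
* §2 THE UNFOLDING (every rank): `toAutomorphicQuotient_inv_mul_arithmetic` (`[(b y)⁻¹] = [y⁻¹]`), `toAutomorphicQuotient_inv_arithmetic_mul_out_inv` (`[(q̃ x̃⁻¹)⁻¹] = x`),
  `borelHeight_arithmeticBorel_mul'`, `measurable_truncWeight`, and **`exists_forall_mul_lintegral_comp_pZX_eq`** — with the ★ constant `C ≠ 0, ∞` of
  `K2E1BLEisensteinInWeightedSpaceU2.exists_ne_zero_lintegral_tsum_borelQuotient_eq_mul_lintegral_fin` (Weil's unfolding `𝔛 ↔ 𝔾`): for ALL `k`, `c`, Borel `F ≥ 0` on `𝔛`,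
  `C · ∫⁻_Z F(p z) d(wtm_{k,c} μZ) = ∫⁻_𝔛 F(x) · Σ'_{q ∈ B(F)∖G(F)} 𝟙_{c < H(q̃ x̃⁻¹)} H(q̃ x̃⁻¹)^{−2k} dμ(x)` (`Z`-side by the letter at
  `Φ = 𝟙_{Z_c} HZ^{−2k} · F∘p`, `𝔾`-integrand `ψ(g) = 𝟙_{c<H(g)} H(g)^{−2k} F([g⁻¹])` left-`B(F)`-invariant, `𝔛`-side by ★ §1; the fibre of `p` over `x = [x̃]` is `{B(F)·q̃ x̃⁻¹}`).

HONEST LABEL.  Count-neutral helper of the BL-SPH-2 template (consumer: part 2 and leaf 2 `K2E1BLBorelOperatorsU2Defs` ∕ P2a, K2E4-p10); closes no socket; HC_CM is proved only modulo the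
7 printed citations (2 remaining named inputs: hLiu418 = `stmt-HodgeConjecture-24832`, h413 = `stmt-HodgeConjecture-24833`) until rung 0 closes.

## References
* [BernsteinLapid2019] J. Bernstein, E. Lapid, *On the meromorphic continuation of Eisenstein series*, J. Amer. Math. Soc. 37 (2024) (arXiv:1911.02342), §4 Claim 4 (p. 10).
* [MoeglinWaldspurger1995] C. Mœglin, J.-L. Waldspurger, *Spectral Decomposition and Eisenstein Series* (1995), I.2.1–I.2.2, I.2.13.
* [Borel1963] A. Borel, *Some finiteness properties of adele groups over number fields*, Publ. Math. IHÉS 16 (1963), §5.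
* [WeilIntegration1965] A. Weil, *L'intégration dans les groupes topologiques et ses applications* (1940), §9 (quotient measures).
-/

set_option autoImplicit false
-- the mandated namespace repeats `HodgeConjecture.HodgeConjecture`, as in every `Theorems/*.lean` of this sub-problem
set_option linter.dupNamespace false

noncomputable section

open MeasureTheory MeasureTheory.Measure Set NumberField IsDedekindDomain Filter Topology
open scoped NNReal ENNReal
open Literature.MeasureTheory.Group Literature.NumberTheory.Automorphic Literature.NumberTheory.Automorphic.UnitaryGroup AdelicGroupData
open Summit.HodgeConjecture.HodgeConjecture.Cruxes.H413.K2E1BLBorelSpacesU2Defs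
open Summit.HodgeConjecture.HodgeConjecture.Cruxes.H413.K2E1BLEisensteinInWeightedSpaceU2

namespace Summit.HodgeConjecture.HodgeConjecture.Cruxes.H413.K2E1BLIotaUnfoldingU

section Plumbing

variable {F E : Type} [Field F] [NumberField F] [Field E] [NumberField E] [Algebra F E] {c : E ≃ₐ[F] E} {N : ℕ}

/-! ## §1 Plumbing (every rank): `B(F)♯`, `π`, `HZ`, `p`, discreteness, and a measure satisfying the letter -/

/-- An element of `B(F)♯ = (arithmeticBorel).map subtype ≤ G(𝔸)` lies in ★ `ratBorelSubgroup = B(𝔸) ⊓ G(F)` (the two spellings of `B(F)` inside `G(𝔸)` agree). [cite: BernsteinLapid2019, §4 p. 9] -/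
theorem mem_ratBorelSubgroup_of_mem_map {γ : (quasiSplit F E c N).Adelic}
    (hγ : γ ∈ (arithmeticBorel F E c N).map (quasiSplit F E c N).arithmeticSubgroup.subtype) : γ ∈ ratBorelSubgroup F E c N := by
  obtain ⟨b, hb, rfl⟩ := Subgroup.mem_map.1 hγ
  exact ⟨(mem_arithmeticBorel_iff b).1 hb, b.2⟩

/-- Conversely `ratBorelSubgroup ≤ B(F)♯`. [cite: BernsteinLapid2019, §4 p. 9] -/
theorem mem_map_of_mem_ratBorelSubgroup {γ : (quasiSplit F E c N).Adelic} (hγ : γ ∈ ratBorelSubgroup F E c N) :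
    γ ∈ (arithmeticBorel F E c N).map (quasiSplit F E c N).arithmeticSubgroup.subtype :=
  Subgroup.mem_map.2 ⟨⟨γ, hγ.2⟩, (mem_arithmeticBorel_iff _).2 hγ.1, rfl⟩

/-- The two spellings of `B(F) ≤ G(𝔸)` are the same subgroup. [cite: BernsteinLapid2019, §4 p. 9] -/
theorem ratBorelSubgroup_eq_map : ratBorelSubgroup F E c N = (arithmeticBorel F E c N).map (quasiSplit F E c N).arithmeticSubgroup.subtype :=
  Subgroup.ext fun _ => ⟨mem_map_of_mem_ratBorelSubgroup, mem_ratBorelSubgroup_of_mem_map⟩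

/-- `π(γ g) = π g` for `γ ∈ B(F)♯`. [cite: BernsteinLapid2019, §4 p. 9] -/
theorem toBorelQuotient_mul_of_mem_map {γ : (quasiSplit F E c N).Adelic}
    (hγ : γ ∈ (arithmeticBorel F E c N).map (quasiSplit F E c N).arithmeticSubgroup.subtype) (g : (quasiSplit F E c N).Adelic) :
    toBorelQuotient F E c N (γ * g) = toBorelQuotient F E c N g :=
  (toBorelQuotient_eq_iff F E c N _ _).2 ⟨⟨γ, mem_ratBorelSubgroup_of_mem_map hγ⟩, rfl⟩

variable [NeZero N]

/-- `HZ` is continuous (`H` is ★ `continuous_borelHeight`, `HZ` its descent along the open quotient map). [cite: BernsteinLapid2019, §4 p. 9] -/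
theorem continuous_borelQuotHeight : Continuous (borelQuotHeight F E c N) :=
  (continuous_borelHeight (F := F) (E := E) (c := c) (N := N)).quotient_lift _

/-- `HZ` is Borel measurable. [cite: BernsteinLapid2019, §4 p. 10] -/
theorem measurable_borelQuotHeight : Measurable (borelQuotHeight F E c N) :=
  (continuous_borelQuotHeight (F := F) (E := E) (c := c) (N := N)).measurable

omit [NeZero N] in
/-- `p : Z → 𝔛` is Borel measurable (★ `continuous_pZX`). [cite: BernsteinLapid2019, §4 p. 10] -/
theorem measurable_pZX : Measurable (pZX F E c N) :=
  (continuous_pZX F E c N).measurable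

omit [NeZero N] in
/-- **`B(F)♯` is discrete in `G(𝔸)`** (it lies in the discrete `G(F)`, ★ `isDiscreteRational_quasiSplit`). [cite: Borel1963, §5] -/
theorem discreteTopology_map_arithmeticBorel : DiscreteTopology ↥((arithmeticBorel F E c N).map (quasiSplit F E c N).arithmeticSubgroup.subtype) := by
  haveI : DiscreteTopology ↥(quasiSplit F E c N).arithmeticSubgroup := isDiscreteRational_quasiSplit
  exact DiscreteTopology.of_subset (inferInstanceAs (DiscreteTopology ↥((quasiSplit F E c N).arithmeticSubgroup : Set (quasiSplit F E c N).Adelic)))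
    (show (((arithmeticBorel F E c N).map (quasiSplit F E c N).arithmeticSubgroup.subtype : Subgroup (quasiSplit F E c N).Adelic) : Set (quasiSplit F E c N).Adelic) ⊆
      ((quasiSplit F E c N).arithmeticSubgroup : Set (quasiSplit F E c N).Adelic) from Subgroup.map_subtype_le _)

omit [NeZero N] in
/-- **THE MEASURE LETTER IS NON-VACUOUS**: for every Haar measure `ν_G` and every covering weight `β` of `B(F)♯` there is a measure `μZ` on `Z = B(F)∖G(𝔸)` with
`∫⁻_Z f dμZ = ∫⁻_𝔾 β · (f ∘ π) dν_G` for all Borel `f ≥ 0` — namely `map π (ν_G|_𝓕)` for a strict Borel fundamental domain `𝓕` of the discrete `B(F)♯` (★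
`Subgroup.exists_measurableSet_existsUnique_smul_mem`), the indicator of `𝓕` being a covering weight (★ `isCoveringWeight_indicator`) and the weight being irrelevant (★
`lintegral_mul_eq_of_coveringSum_eq`). [cite: WeilIntegration1965, §9] [cite: Borel1963, §5] -/
theorem exists_measure_forall_lintegral_eq [MeasurableSpace (quasiSplit F E c N).Adelic] [BorelSpace (quasiSplit F E c N).Adelic]
    (νG : Measure (quasiSplit F E c N).Adelic) [νG.IsMulLeftInvariant]
    {β : (quasiSplit F E c N).Adelic → ℝ≥0∞} (hβ : IsCoveringWeight ↥((arithmeticBorel F E c N).map (quasiSplit F E c N).arithmeticSubgroup.subtype) β) :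
    ∃ μZ : Measure (borelQuotient F E c N), ∀ f : borelQuotient F E c N → ℝ≥0∞, Measurable f →
      ∫⁻ z, f z ∂μZ = ∫⁻ g, β g * f (toBorelQuotient F E c N g) ∂νG := by
  classical
  haveI := t2Space_adeleRing_of_numberField E
  haveI := locallyCompactSpace_adeleRing' E
  haveI := secondCountableTopology_adeleRing E
  haveI : SecondCountableTopology (quasiSplit F E c N).Adelic := inferInstanceAs (SecondCountableTopology (adelic F E c N ((StdForm.antidiagonal N).over E)))
  haveI := discreteTopology_map_arithmeticBorel (F := F) (E := E) (c := c) (N := N)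
  set Γ : Subgroup (quasiSplit F E c N).Adelic := (arithmeticBorel F E c N).map (quasiSplit F E c N).arithmeticSubgroup.subtype with hΓ
  haveI : Countable Γ := by
    haveI : SecondCountableTopology Γ := TopologicalSpace.Subtype.secondCountableTopology _
    exact countable_of_Lindelof_of_discrete
  haveI := K2E1IntertwiningAdjointEngine.measurableConstSMul_subgroup Γ
  haveI := K2E1IntertwiningAdjointEngine.smulInvariantMeasure_subgroup Γ νG
  obtain ⟨𝓕, h𝓕m, h𝓕⟩ := Subgroup.exists_measurableSet_existsUnique_smul_mem Γ
  have hπm : Measurable (toBorelQuotient F E c N) := (continuous_toBorelQuotient F E c N).measurable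
  refine ⟨Measure.map (toBorelQuotient F E c N) (νG.restrict 𝓕), fun f hf => ?_⟩
  have hind := isCoveringWeight_indicator (Γ := Γ) h𝓕m h𝓕
  have hfinv : ∀ (γ : Γ) (x : (quasiSplit F E c N).Adelic), f (toBorelQuotient F E c N (γ • x)) = f (toBorelQuotient F E c N x) := fun γ x => by
    rw [Subgroup.smul_def, smul_eq_mul, toBorelQuotient_mul_of_mem_map γ.2]
  rw [lintegral_map hf hπm, ← lintegral_indicator h𝓕m]
  have h1 : (fun g => 𝓕.indicator (fun g => f (toBorelQuotient F E c N g)) g) = fun g => f (toBorelQuotient F E c N g) * 𝓕.indicator 1 g := by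
    funext g
    by_cases hg : g ∈ 𝓕
    · rw [Set.indicator_of_mem hg, Set.indicator_of_mem hg, Pi.one_apply, mul_one]
    · rw [Set.indicator_of_notMem hg, Set.indicator_of_notMem hg, mul_zero]
  rw [h1, lintegral_mul_eq_of_coveringSum_eq νG (F := fun g => f (toBorelQuotient F E c N g)) (hf.comp hπm) hfinv hind.measurable hβ.measurable one_ne_zero
    ENNReal.one_ne_top hind.coveringSum_eq hβ.coveringSum_eq]
  exact lintegral_congr fun g => mul_comm _ _

end Plumbing

/-! ## §2 The unfolding `C · ∫⁻_Z F∘p d(wtm) = ∫⁻_𝔛 F · Σ'_q 𝟙_{c<H(q̃x̃⁻¹)} H(q̃x̃⁻¹)^{−2k} dμ` (every rank) -/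

section Unfolding

variable {F E : Type} [Field F] [NumberField F] [Field E] [NumberField E] [Algebra F E] {c : E ≃ₐ[F] E} {N : ℕ}

/-- `[(b y)⁻¹] = [y⁻¹]` in `𝔛 = 𝔾 ⧸ G(F)` for `b ∈ G(F)`. [cite: Borel1963, §5] -/
theorem toAutomorphicQuotient_inv_mul_arithmetic (b : (quasiSplit F E c N).arithmeticSubgroup) (y : (quasiSplit F E c N).Adelic) :
    (quasiSplit F E c N).toAutomorphicQuotient ((b : (quasiSplit F E c N).Adelic) * y)⁻¹ = (quasiSplit F E c N).toAutomorphicQuotient y⁻¹ := by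
  rw [_root_.mul_inv_rev]
  exact QuotientGroup.mk_mul_of_mem _ (inv_mem ((quasiSplit F E c N).arithmeticSubgroup_le_quotientSubgroup b.2))

/-- `[(q̃ · x̃⁻¹)⁻¹] = x` for `q̃ ∈ G(F)` and the Mathlib representative `x̃ = x.out` of `x ∈ 𝔛`. [cite: Borel1963, §5] -/
theorem toAutomorphicQuotient_inv_arithmetic_mul_out_inv (γ : (quasiSplit F E c N).arithmeticSubgroup) (x : (quasiSplit F E c N).automorphicQuotient) :
    (quasiSplit F E c N).toAutomorphicQuotient ((γ : (quasiSplit F E c N).Adelic) * (Quotient.out x : (quasiSplit F E c N).Adelic)⁻¹)⁻¹ = x := by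
  rw [toAutomorphicQuotient_inv_mul_arithmetic, inv_inv]
  exact QuotientGroup.out_eq' x

variable [NeZero N]

/-- `H(b y) = H(y)` for `b ∈ B(F) ≤ G(F)` (★ `borelHeight_rational_borel_mul`, product formula). [cite: MoeglinWaldspurger1995, I.2.1] -/
theorem borelHeight_arithmeticBorel_mul' {b : (quasiSplit F E c N).arithmeticSubgroup} (hb : b ∈ arithmeticBorel F E c N) (y : (quasiSplit F E c N).Adelic) :
    borelHeight ((b : (quasiSplit F E c N).Adelic) * y) = borelHeight y := by
  obtain ⟨r, hr⟩ := b.2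
  have hrB : (quasiSplit F E c N).toAdelic r ∈ borelAdelic F E c N := by rw [hr]; exact (mem_arithmeticBorel_iff b).1 hb
  rw [← hr]
  exact borelHeight_rational_borel_mul r hrB y

variable [MeasurableSpace (quasiSplit F E c N).Adelic] [BorelSpace (quasiSplit F E c N).Adelic]

/-- The truncated weight `𝟙_{c < H} · H^{−2k}` on `𝔾` is Borel. [cite: BernsteinLapid2019, §4 p. 10] -/
theorem measurable_truncWeight (k : ℕ) (c₀ : ℝ≥0) :
    Measurable fun y : (quasiSplit F E c N).Adelic =>
      {y : (quasiSplit F E c N).Adelic | c₀ < borelHeight y}.indicator (fun y => (((borelHeight y)⁻¹ ^ (2 * k) : ℝ≥0) : ℝ≥0∞)) y := by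
  have hH : Measurable (borelHeight : (quasiSplit F E c N).Adelic → ℝ≥0) := continuous_borelHeight.measurable
  exact ((hH.inv.pow_const _).coe_nnreal_ennreal).indicator (measurableSet_lt measurable_const hH)

/-- **THE UNFOLDING OF `p : Z_c → 𝔛` AGAINST THE WEIGHT `H^{−2k}`** (every rank).  Under the measure letter `hμZ` (`μZ` = the `B(F)`-quotient of `ν_G` in covering-weight
currency) there is a constant `C ≠ 0, ∞` (Weil's, from ★ `exists_ne_zero_lintegral_tsum_borelQuotient_eq_mul_lintegral_fin`) such that for ALL `k`, `c` and Borel `F ≥ 0` on `𝔛`: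
`C · ∫⁻_Z F(p z) d(wtm_{k,c} μZ)(z) = ∫⁻_𝔛 F(x) · Σ'_{q ∈ B(F)∖G(F)} 𝟙_{c < H(q̃ x̃⁻¹)} H(q̃ x̃⁻¹)^{−2k} dμ(x)` — the fibre of `p` over `x = [x̃]` is `{B(F)·q̃ x̃⁻¹ : q ∈ B(F)∖G(F)}` and
`ψ(g) := 𝟙_{c<H(g)} H(g)^{−2k} · F([g⁻¹])` is left-`B(F)`-invariant. [cite: BernsteinLapid2019, §4 Claim 4 (p. 10)] [cite: MoeglinWaldspurger1995, I.2.1] -/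
theorem exists_forall_mul_lintegral_comp_pZX_eq
    (μ : Measure (quasiSplit F E c N).automorphicQuotient) [(quasiSplit F E c N).IsAutomorphicMeasure μ]
    (νG : Measure (quasiSplit F E c N).Adelic) [νG.IsHaarMeasure] [νG.IsInvInvariant]
    {β : (quasiSplit F E c N).Adelic → ℝ≥0∞} (hβ : IsCoveringWeight ↥((arithmeticBorel F E c N).map (quasiSplit F E c N).arithmeticSubgroup.subtype) β)
    {μZ : Measure (borelQuotient F E c N)}
    (hμZ : ∀ f : borelQuotient F E c N → ℝ≥0∞, Measurable f → ∫⁻ z, f z ∂μZ = ∫⁻ g, β g * f (toBorelQuotient F E c N g) ∂νG) :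
    ∃ C : ℝ≥0∞, C ≠ 0 ∧ C ≠ ⊤ ∧ ∀ (k : ℕ) (c₀ : ℝ≥0) (Φ : (quasiSplit F E c N).automorphicQuotient → ℝ≥0∞), Measurable Φ →
      C * ∫⁻ z, Φ (pZX F E c N z) ∂(weightedTruncMeasure F E c N k c₀ μZ) =
        ∫⁻ x, Φ x * ∑' q : Quotient (QuotientGroup.rightRel (arithmeticBorel F E c N)),
          {y : (quasiSplit F E c N).Adelic | c₀ < borelHeight y}.indicator (fun y => (((borelHeight y)⁻¹ ^ (2 * k) : ℝ≥0) : ℝ≥0∞))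
            (((q.out : (quasiSplit F E c N).arithmeticSubgroup) : (quasiSplit F E c N).Adelic) *
              (Quotient.out x : (quasiSplit F E c N).Adelic)⁻¹) ∂μ := by
  obtain ⟨C, hC0, hCt, hunf⟩ := exists_ne_zero_lintegral_tsum_borelQuotient_eq_mul_lintegral_fin (F := F) (E := E) (c := c) (N := N) μ νG
  refine ⟨C, hC0, hCt, fun k c₀ Φ hΦ => ?_⟩
  -- the weight on `𝔾` and the unfolded integrand `ψ`
  set Gw : (quasiSplit F E c N).Adelic → ℝ≥0∞ := fun y =>
    {y : (quasiSplit F E c N).Adelic | c₀ < borelHeight y}.indicator (fun y => (((borelHeight y)⁻¹ ^ (2 * k) : ℝ≥0) : ℝ≥0∞)) y with hGw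
  set ψ : (quasiSplit F E c N).Adelic → ℝ≥0∞ := fun g => Gw g * Φ ((quasiSplit F E c N).toAutomorphicQuotient g⁻¹) with hψ
  have hGwm : Measurable Gw := measurable_truncWeight k c₀
  have hψm : Measurable ψ := hGwm.mul (hΦ.comp (((quasiSplit F E c N).continuous_toAutomorphicQuotient).measurable.comp measurable_inv))
  have hψB : ∀ b ∈ arithmeticBorel F E c N, ∀ y : (quasiSplit F E c N).Adelic, ψ ((b : (quasiSplit F E c N).Adelic) * y) = ψ y := by
    intro b hb y
    simp only [hψ, hGw, Set.indicator, Set.mem_setOf_eq, borelHeight_arithmeticBorel_mul' hb, toAutomorphicQuotient_inv_mul_arithmetic]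
  -- the `Z`-side: unfold the weighted truncated measure and apply the letter
  have hS : MeasurableSet {z : borelQuotient F E c N | c₀ < borelQuotHeight F E c N z} :=
    measurableSet_lt measurable_const measurable_borelQuotHeight
  have hd : Measurable fun z : borelQuotient F E c N => (((borelQuotHeight F E c N z)⁻¹ ^ (2 * k) : ℝ≥0) : ℝ≥0∞) :=
    (measurable_borelQuotHeight.inv.pow_const _).coe_nnreal_ennreal
  have hZ : ∫⁻ z, Φ (pZX F E c N z) ∂(weightedTruncMeasure F E c N k c₀ μZ) = ∫⁻ g, β g * ψ g ∂νG := by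
    rw [weightedTruncMeasure, lintegral_withDensity_eq_lintegral_mul _ hd (g := fun z => Φ (pZX F E c N z)) (hΦ.comp measurable_pZX), ← lintegral_indicator hS,
      hμZ]
    · refine lintegral_congr fun g => ?_
      congr 1
      by_cases hg : c₀ < borelHeight g
      · have hmem : toBorelQuotient F E c N g ∈ {z : borelQuotient F E c N | c₀ < borelQuotHeight F E c N z} := hg
        have hmem' : g ∈ {y : (quasiSplit F E c N).Adelic | c₀ < borelHeight y} := hg
        rw [Set.indicator_of_mem hmem, hψ, hGw]
        simp only [Set.indicator_of_mem hmem', Pi.mul_apply, borelQuotHeight_toBorelQuotient, pZX_toBorelQuotient]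
      · have hmem : toBorelQuotient F E c N g ∉ {z : borelQuotient F E c N | c₀ < borelQuotHeight F E c N z} := hg
        have hmem' : g ∉ {y : (quasiSplit F E c N).Adelic | c₀ < borelHeight y} := hg
        rw [Set.indicator_of_notMem hmem, hψ, hGw]
        simp only [Set.indicator_of_notMem hmem', zero_mul]
    · exact (hd.mul (hΦ.comp measurable_pZX)).indicator hS
  -- the `𝔛`-side: ★ §1 of `K2E1BLEisensteinInWeightedSpaceU2`
  rw [hZ, ← hunf β hβ ψ hψm hψB]
  refine lintegral_congr fun x => ?_
  have hterm : ∀ q : Quotient (QuotientGroup.rightRel (arithmeticBorel F E c N)),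
      ψ (((q.out : (quasiSplit F E c N).arithmeticSubgroup) : (quasiSplit F E c N).Adelic) * (Quotient.out x : (quasiSplit F E c N).Adelic)⁻¹) =
        Gw (((q.out : (quasiSplit F E c N).arithmeticSubgroup) : (quasiSplit F E c N).Adelic) * (Quotient.out x : (quasiSplit F E c N).Adelic)⁻¹) * Φ x := fun q => by
    rw [hψ]
    simp only [toAutomorphicQuotient_inv_arithmetic_mul_out_inv]
  simp only [hterm]
  rw [ENNReal.tsum_mul_right, mul_comm]

end Unfolding


end Summit.HodgeConjecture.HodgeConjecture.Cruxes.H413.K2E1BLIotaUnfoldingU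

end
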